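import Literature.NumberTheory.GaloisRepresentations.LubinTateColemanAdicFixedPoint
import Mathlib.Algebra.Ring.GeomSum
import Mathlib.Data.Nat.Choose.Dvd
import HarnessLib

/-!
# `S⟦X⟧ ≅ lim←_n S⟦X⟧/(ω_n)`, `ω_n = (1 + X)^{p^n} − 1`: the Iwasawa algebra as the projective limit of its layers (Washington, Thm. 7.1)

Washington, *Introduction to Cyclotomic Fields* (1997), Theorem 7.1: `ℤ_p⟦T⟧ ≅ lim← ℤ_p[T]/((1+T)^{p^n} − 1)` (`= lim← ℤ_p[ℤ/p^nℤ] = ℤ_p⟦ℤ_p⟧`,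
§7.1); de Shalit, *Iwasawa theory of elliptic curves with complex multiplication* (1987), Ch. I §3.1: `Λ(G, M) = lim← M[G/H] = M⟦G⟧` and "`Λ ≅ ℤ_p⟦S⟧`
non-canonically … maps `u^α` to `(1+S)^α`".  This file proves the projective-limit statement for power series over ANY commutative ring `S`
that is `(p)`-adically complete (`p` any natural number — primality is never used), in the coefficientwise `(p, X)`-adic currency of the tree (`LubinTate.adicFiltGen`): with
`ω_n := (1 + X)^{p^n} − 1 ∈ S⟦X⟧`,

* `omega_succ` — `ω_{n+1} = ω_n · Σ_{i<p} (1+X)^{p^n i}`; `omega_dvd_omega` (`ω_n ∣ ω_m` for `n ≤ m`);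
* `mem_adicFiltGen_one_iff` (`V ∈ I_1 ⟺ V(0) ∈ (p)`), `geomSum_mem_adicFiltGen_one` (the cofactor has constant term `p`),
  ★ `omega_mem_adicFiltGen` — **`ω_n ∈ I_{n+1} = (p, X)^{n+1}`** (coefficientwise), `omega_mul_mem_adicFiltGen`;
* ★★ `eq_of_forall_omega_dvd_sub` — **`⋂_n (ω_n) = 0`**: the map `S⟦X⟧ → lim←_n S⟦X⟧/(ω_n)` is injective (`S` `(p)`-adically Hausdorff);
* ★★★ `exists_forall_omega_dvd_sub` — **it is onto**: every family `(f_n)` with `ω_n ∣ f_{n+1} − f_n` is `≡ g (mod ω_n)` for one `g ∈ S⟦X⟧`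
  (`S` `(p)`-adically complete; the limit `g = lim f_n` exists coefficientwise, and `(g − f_n)/ω_n` is the convergent series
  `Σ_{k≥n} (ω_k/ω_n)·s_k` — no Weierstrass division needed).

So `S⟦X⟧ = lim←_n S⟦X⟧/(ω_n)` for `S = 𝒪_F`, `𝒪_E`, `ℤ_p`, … .  Everything PROVED (0 sorry, no named facts, no new definitions).  Use: the unramified
half of the `Λ`-packaging of the Coleman coordinates (`LubinTateUnramifiedTowerCoordinates`: `lim←_{Tr} 𝒪_{E_m} ≅` compatible families of functions
on the cyclic groups `Gal(E_m/F)`) — the compatible families of `S[ℤ/p^nℤ] = S[X]/((1+X)^{p^n} − 1)` are the Iwasawa algebra `S⟦X⟧`.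

## References

* L. C. Washington, *Introduction to Cyclotomic Fields*, 2nd ed. (1997), §7.1, Theorem 7.1. [Washington1997]
* E. de Shalit, *Iwasawa theory of elliptic curves with complex multiplication* (1987), Ch. I §3.1. [deShalit1987]
-/

noncomputable section

namespace Literature.NumberTheory.EllipticCurves

namespace IwasawaOmega

open Literature.NumberTheory.GaloisRepresentations.LubinTate Finset

variable {S : Type*} [CommRing S] (p : ℕ)

/-! ### The polynomials `ω_n = (1 + X)^{p^n} − 1` -/

/-- **`ω_{n+1} = ω_n · Σ_{i<p} ((1+X)^{p^n})^i`** (`a^p − 1 = (a − 1)(1 + a + ⋯ + a^{p−1})`). [cite: Washington1997, §7.1 Theorem 7.1] -/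
theorem omega_succ (n : ℕ) :
    ((1 + PowerSeries.X : PowerSeries S) ^ p ^ (n + 1) - 1) =
      ((1 + PowerSeries.X : PowerSeries S) ^ p ^ n - 1) * ∑ i ∈ range p, ((1 + PowerSeries.X : PowerSeries S) ^ p ^ n) ^ i := by
  rw [mul_geom_sum, ← pow_mul, pow_succ]

/-- `ω_n ∣ ω_{n+j}`. [cite: Washington1997, §7.1 Theorem 7.1] -/
theorem omega_dvd_omega_add (n j : ℕ) :
    ((1 + PowerSeries.X : PowerSeries S) ^ p ^ n - 1) ∣ ((1 + PowerSeries.X : PowerSeries S) ^ p ^ (n + j) - 1) := by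
  induction j with
  | zero => exact dvd_rfl
  | succ j ih => rw [← Nat.add_assoc, omega_succ]; exact dvd_mul_of_dvd_left ih _

/-- `ω_n ∣ ω_m` for `n ≤ m`. [cite: Washington1997, §7.1 Theorem 7.1] -/
theorem omega_dvd_omega {n m : ℕ} (h : n ≤ m) :
    ((1 + PowerSeries.X : PowerSeries S) ^ p ^ n - 1) ∣ ((1 + PowerSeries.X : PowerSeries S) ^ p ^ m - 1) := by
  obtain ⟨j, rfl⟩ := Nat.exists_eq_add_of_le h
  exact omega_dvd_omega_add p n j

/-! ### `ω_n` in the `(p, X)`-adic filtration -/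

/-- `V ∈ I_1 ⟺ V(0) ∈ (p)` (the filtration step `I_1 = (p, X)`). [cite: deShalit1987, Ch. I §3.13 Lemma (proof)] -/
theorem mem_adicFiltGen_one_iff (V : PowerSeries S) :
    V ∈ adicFiltGen (p : S) 1 ↔ PowerSeries.constantCoeff V ∈ Ideal.span {(p : S)} := by
  rw [mem_adicFiltGen_iff]
  constructor
  · intro h
    have h0 := h 0
    rwa [Nat.sub_zero, pow_one, PowerSeries.coeff_zero_eq_constantCoeff] at h0
  · intro h k
    rcases Nat.eq_zero_or_pos k with rfl | hk
    · rwa [Nat.sub_zero, pow_one, PowerSeries.coeff_zero_eq_constantCoeff]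
    · rw [show 1 - k = 0 by omega, pow_zero, Ideal.span_singleton_one]; exact Submodule.mem_top

/-- The cofactor `Σ_{i<p} ((1+X)^{p^n})^i` has constant term `p`, so lies in `I_1`. [cite: Washington1997, §7.1 Theorem 7.1] -/
theorem geomSum_mem_adicFiltGen_one (n : ℕ) :
    (∑ i ∈ range p, ((1 + PowerSeries.X : PowerSeries S) ^ p ^ n) ^ i) ∈ adicFiltGen (p : S) 1 := by
  rw [mem_adicFiltGen_one_iff, map_sum]
  have e : ∀ i ∈ range p, PowerSeries.constantCoeff (((1 + PowerSeries.X : PowerSeries S) ^ p ^ n) ^ i) = 1 := fun i _ => by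
    rw [map_pow, map_pow, map_add, map_one, PowerSeries.constantCoeff_X, add_zero, one_pow, one_pow]
  rw [sum_congr rfl e, sum_const, card_range, nsmul_eq_mul, mul_one]
  exact Ideal.mem_span_singleton_self _

/-- ★ **`ω_n ∈ I_{n+1}`** (`ω_0 = X ∈ I_1`, `ω_{n+1} = ω_n · ν_n` with `ν_n ∈ I_1`). [cite: Washington1997, §7.1 Theorem 7.1] -/
theorem omega_mem_adicFiltGen (n : ℕ) : ((1 + PowerSeries.X : PowerSeries S) ^ p ^ n - 1) ∈ adicFiltGen (p : S) (n + 1) := by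
  induction n with
  | zero =>
    rw [pow_zero, pow_one, add_sub_cancel_left]
    exact mem_adicFiltGen_one_of_constantCoeff_eq_zero PowerSeries.constantCoeff_X
  | succ n ih =>
    rw [omega_succ]
    exact mul_mem_adicFiltGen ih (geomSum_mem_adicFiltGen_one p n)

/-- `ω_n · s ∈ I_{n+1}` for every `s`. [cite: Washington1997, §7.1 Theorem 7.1] -/
theorem omega_mul_mem_adicFiltGen (n : ℕ) (s : PowerSeries S) :
    ((1 + PowerSeries.X : PowerSeries S) ^ p ^ n - 1) * s ∈ adicFiltGen (p : S) (n + 1) := by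
  have h := mul_mem_adicFiltGen (omega_mem_adicFiltGen p n) (mem_adicFiltGen_zero (p := (p : S)) s)
  rwa [Nat.add_zero] at h

/-! ### Injectivity: `⋂_n (ω_n) = 0` -/

/-- ★★ **`S⟦X⟧ → lim←_n S⟦X⟧/(ω_n)` is injective** (`S` `(p)`-adically Hausdorff): if `ω_n ∣ g − g'` for all `n` then `g = g'`.
[cite: Washington1997, §7.1 Theorem 7.1] -/
theorem eq_of_forall_omega_dvd_sub [IsHausdorff (Ideal.span {(p : S)}) S] {g g' : PowerSeries S}
    (h : ∀ n, ((1 + PowerSeries.X : PowerSeries S) ^ p ^ n - 1) ∣ g - g') : g = g' := by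
  refine sub_eq_zero.mp (eq_zero_of_forall_mem_adicFiltGen (p := (p : S)) fun N => ?_)
  obtain ⟨s, hs⟩ := h N
  rw [hs]
  exact adicFiltGen_mono (Nat.le_succ N) (omega_mul_mem_adicFiltGen p N s)

/-! ### Surjectivity: compatible families lift -/

/-- ★★★ **`S⟦X⟧ → lim←_n S⟦X⟧/(ω_n)` is onto** (`S` `(p)`-adically complete): for every family `(f_n)` of power series with `ω_n ∣ f_{n+1} − f_n`
there is `g` with `ω_n ∣ g − f_n` for all `n`.  Proof: `f_{n+1} − f_n ∈ (ω_n) ⊆ I_{n+1}`, so `g = lim f_n` exists coefficientwise; for fixed `n`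
the quotients `(f_k − f_n)/ω_n = Σ_{n ≤ j < k} (ω_j/ω_n) s_j` converge as well (`ω_j/ω_n ∈ I_{j−n}`), and the limit `T` satisfies `ω_n T = g − f_n`
because `⋂ I_N = 0`. [cite: Washington1997, §7.1 Theorem 7.1] -/
theorem exists_forall_omega_dvd_sub [IsAdicComplete (Ideal.span {(p : S)}) S] (f : ℕ → PowerSeries S)
    (hf : ∀ n, ((1 + PowerSeries.X : PowerSeries S) ^ p ^ n - 1) ∣ f (n + 1) - f n) :
    ∃ g : PowerSeries S, ∀ n, ((1 + PowerSeries.X : PowerSeries S) ^ p ^ n - 1) ∣ g - f n := by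
  -- notation `ω`, the cofactors `ν`, the successive quotients `s`
  obtain ⟨ω, hω⟩ : ∃ ω : ℕ → PowerSeries S, ∀ n, ω n = (1 + PowerSeries.X : PowerSeries S) ^ p ^ n - 1 := ⟨_, fun n => rfl⟩
  obtain ⟨ν, hν⟩ : ∃ ν : ℕ → PowerSeries S, ∀ n, ν n = ∑ i ∈ range p, ((1 + PowerSeries.X : PowerSeries S) ^ p ^ n) ^ i :=
    ⟨_, fun n => rfl⟩
  have hωsucc : ∀ n, ω (n + 1) = ω n * ν n := fun n => by rw [hω, hω, hν]; exact omega_succ p n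
  have hνI : ∀ n, ν n ∈ adicFiltGen (p : S) 1 := fun n => by rw [hν]; exact geomSum_mem_adicFiltGen_one p n
  have hωI : ∀ n, ω n ∈ adicFiltGen (p : S) (n + 1) := fun n => by rw [hω]; exact omega_mem_adicFiltGen p n
  have hs := fun n => hf n
  choose s hs using hs
  simp only [← hω] at hs
  -- the limit `g`
  obtain ⟨g, hg⟩ := exists_forall_sub_mem_adicFiltGen (p := (p : S)) f fun N => by
    rw [hs]; have h := mul_mem_adicFiltGen (hωI N) (mem_adicFiltGen_zero (p := (p : S)) (s N)); rwa [Nat.add_zero] at h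
  refine ⟨g, fun n => ?_⟩
  rw [← hω]
  -- the cofactors `μ_j = ω_{n+j}/ω_n ∈ I_j`
  obtain ⟨μ, hμ0, hμsucc⟩ : ∃ μ : ℕ → PowerSeries S, μ 0 = 1 ∧ ∀ j, μ (j + 1) = μ j * ν (n + j) :=
    ⟨fun j => Nat.rec 1 (fun j m => m * ν (n + j)) j, rfl, fun j => rfl⟩
  have hμω : ∀ j, ω (n + j) = ω n * μ j := by
    intro j
    induction j with
    | zero => rw [Nat.add_zero, hμ0, mul_one]
    | succ j ih => rw [← Nat.add_assoc, hωsucc, ih, hμsucc, mul_assoc]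
  have hμI : ∀ j, μ j ∈ adicFiltGen (p : S) j := by
    intro j
    induction j with
    | zero => exact mem_adicFiltGen_zero _
    | succ j ih => rw [hμsucc]; exact mul_mem_adicFiltGen ih (hνI (n + j))
  -- partial quotients `Q_j = Σ_{i<j} μ_i s_{n+i}` with `ω_n Q_j = f_{n+j} − f_n`
  obtain ⟨Q, hQ⟩ : ∃ Q : ℕ → PowerSeries S, ∀ j, Q j = ∑ i ∈ range j, μ i * s (n + i) := ⟨_, fun j => rfl⟩
  have hQω : ∀ j, ω n * Q j = f (n + j) - f n := by
    intro j
    induction j with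
    | zero => rw [hQ, sum_range_zero, mul_zero, Nat.add_zero, sub_self]
    | succ j ih =>
      rw [hQ, sum_range_succ, ← hQ, mul_add, ih, ← mul_assoc, ← hμω, ← hs (n + j), ← Nat.add_assoc]
      ring
  -- the quotients converge: `Q_{j+2} − Q_{j+1} = μ_{j+1} s ∈ I_{j+1}`
  obtain ⟨T, hT⟩ := exists_forall_sub_mem_adicFiltGen (p := (p : S)) (fun j => Q (j + 1)) fun j => by
    rw [hQ, hQ, sum_range_succ, add_sub_cancel_left]
    have h := mul_mem_adicFiltGen (hμI (j + 1)) (mem_adicFiltGen_zero (p := (p : S)) (s (n + (j + 1))))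
    rwa [Nat.add_zero] at h
  -- `ω_n T = g − f_n` since the difference lies in every `I_N`
  refine ⟨T, ?_⟩
  refine sub_eq_zero.mp (eq_zero_of_forall_mem_adicFiltGen (p := (p : S)) fun N => ?_)
  have e : g - f n - ω n * T = (g - f (n + (N + 1))) - ω n * (T - Q (N + 1)) := by
    rw [mul_sub, hQω]; ring
  rw [e]
  refine sub_mem (adicFiltGen_mono (by omega) (hg (n + (N + 1)))) ?_
  have h := mul_mem_adicFiltGen (mem_adicFiltGen_zero (p := (p : S)) (ω n)) (hT N)
  rw [Nat.zero_add] at h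
  exact adicFiltGen_mono (Nat.le_succ N) h

end IwasawaOmega

end Literature.NumberTheory.EllipticCurves
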